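import Literature.Computability.AlgebraicComplexity.PowerSumProductObstructions
import Literature.Computability.AlgebraicComplexity.TableauHighestWeight
import Literature.Computability.AlgebraicComplexity.HwvIdealRankBound
import Mathlib.LinearAlgebra.Vandermonde
import Mathlib.LinearAlgebra.Matrix.Permanent
import HarnessLib

/-!
# An equation of type `ν = (4m, 2m, …, 2m)` for the forms of Waring rank `≤ m`, and
# Ikenmeyer–Kandasamy's Prop. 5.3 (first bullet): `ν` is not a vanishing-ideal occurrence
# obstruction

Topic `Literature/Computability/AlgebraicComplexity` (geometric complexity theory: the toy pair
power sum `p = x₁^m + ⋯ + x_m^m` versus the monomial `q = x₁ ⋯ x_m` of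
`PowerSumProductObstructions.lean`). This file DISCHARGES the named fact `IK2020_prop_5_3_1`:

* C. Ikenmeyer, U. Kandasamy, *Implementing geometric complexity theory: On the separation of
  orbit closures via symmetries*, STOC 2020 = arXiv:1911.03990, Prop. 5.3, first bullet (e-print
  p. 10): with `m = D ≥ 4` even, `d = 2`, `ν = (2m) + (m × 2m) = (4m, 2m, …, 2m) ⊢ 2m(m+1)`,
  "`mult_{ν^*} ℂ[\overline{Gp}] < a_ν(2(m+2),m)` [read `a_ν(2(m+1), m)`] and hence `ν` is not a
  vanishing ideal occurrence obstruction."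

as `theorem IK2020_prop_5_3_1_holds : IK2020_prop_5_3_1` (honest framing of the cell served,
`pub-gct-max` track T: a kernel discharge of one cited, printed proposition about the toy model;
nothing here is a claim on VP vs VNP or P vs NP).

## The printed proof and what is followed

IK prove the bullet from `mult_{ν^*} ℂ[\overline{Gp}] = mult_{ν^*} ℂ[Gp] = 2` (Lemma 5.2,
Prop. 4.1, Thm. 4.3 — the second equality is their Main Technical Theorem 4.2 / the Tableau
Lifting Theorem) and `a_ν(2(m+1), m) ≥ 3` (Prop. 12.1). Prop. 12.1 in turn is proved (§12,
"An equation for Waring rank", p. 18) by exhibiting, next to the two highest-weight vectors that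
do not vanish on `Gp`, a THIRD nonzero highest-weight vector `f` of weight `ν^*` in
`ℂ[Sym^m ℂ^m]_{2m+2}` that VANISHES on `Gp` ("in particular we construct an equation that
vanishes on all polynomials of Waring rank at most `m`"). For the INEQUALITY of Prop. 5.3 the
exact values are not needed: by rank–nullity on the restriction map
`HWV_{ν^*}(ℂ[Sym^m ℂ^m]_{2m+2}) ↠ HWV_{ν^*}(ℂ[\overline{Gp}])` (Dörfler–Ikenmeyer–Panova 2020 §5;
tree: `orbitMultiplicity_lt_plethysmCoeff_of_mem_orbitVanishingIdeal`, `HwvIdealRankBound.lean`)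
ONE nonzero highest-weight vector of weight `ν^*` in the vanishing ideal gives
`mult_{ν^*} ℂ[\overline{Gp}] < a_ν(2(m+1), m)`. So this file formalizes exactly IK's third
function `f` (§12) and its two properties, following the printed argument:

1. **The tableau** (§12): `T = T_left + T_right` (row concatenation, IK §3), filled with the
   `n = 2m+2` labels, each exactly `m` times; `f = (A ↦ γ(A M_{n,m} T))` is "either zero or a HWV
   of weight `sh(T)^*`" (Thm. 11.1, last clause). In the tree `f` is the TABLEAU POLYNOMIAL
   `TabM.tabPoly` of the datum `IK2020.ikTab` (`TableauPolynomial.lean`; highest weight by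
   `TabM.tabPoly_mem_highestWeightSpace`, `TableauHighestWeight.lean`): `IK2020.ikPoly`,
   `IK2020.ikPoly_mem_highestWeightSpace`.
2. **Thm. 11.1's evaluation formula** at a sum of powers `A · p = ℓ₁^m + ⋯ + ℓ_n^m` (`ℓ_j` the
   columns of `A`): `f(A·p) = ∑_{φ : [δ] → [n]} ∏_c det(…)` = `γ(A M_{δ,m} T)` — here, for any
   tableau datum with a frame, `TabM.EC_powers` (from the polarisation identity
   `aeval_formCoeff_tabPoly` exactly as `EC_mapForms_expand` of `TableauScaling.lean`).
3. **`f` vanishes on `Gp`** (§12: "no tableau in `M_{m+2,m} T_left` is regular … every symbol …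
   appears a multiple of `m` many times"): every relabelling of the `m+2` labels of `T_left` by
   `m` values repeats a value in some column of `T_left`, whose determinant then has two equal
   columns (`IK2020.exists_column_repeat`, `IK2020.ikPoly_mem_orbitVanishingIdeal`).
4. **`f ≠ 0`** (Claim 12.2, "in complete analogy to [bci:10]" = Bürgisser–Christandl–Ikenmeyer,
   *Even partitions in plethysms*): `T` is DUPLEX (each column occurs an even number of times),
   so at a generic real `m × n` matrix every summand `∏_c det` is a product of squares and the
   identity relabelling contributes a positive one. We evaluate at the INTEGER point
   `ℓ_j = ((j+1)^{m-1-v})_v`, where every column determinant is a Vandermonde determinant in the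
   integers `φ(label) + 1` (`IK2020.sum_prod_vdet_pos`, `IK2020.ikPoly_ne_zero`).

## Deviations from print (recorded, both inside §12's proof; the proposition is AS PRINTED)

* **Shape of `T_right` (erratum).** As printed, `T_left` is the `m × (m+2)` rectangle and
  `T_right` "the `(m × 2) + (m² − 2m)` tableau", so that `sh(T) = sh(T_left) + sh(T_right)
  = (m² − m + 4, (m+4)^{m−1})`, which is `ν = (4m, (2m)^{m−1})` ONLY for `m = 4` (the displayed
  `m = 6` example has shape `(34, 10⁵)`, `ν = (24, 12⁵)`). We use `T_right` of shape
  `(m × (m−2)) + (2m)`: `m − 2` equal full columns `(m+3, …, 2m+2)ᵀ` and `2m` singleton columns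
  carrying each of `m+3, …, 2m+2` twice — content `m` per label, duplex for even `m`, and
  literally the printed tableau at `m = 4`; with it `sh(T) = ν` for every even `m ≥ 4` and the
  printed argument goes through word for word (only `T_left` enters the vanishing argument).
* **Filling of `T_left`.** IK fill the `m × (m+2)` rectangle row by row with `m` 1s, `m` 2s, …;
  we use the column-pair filling in which the columns `2P, 2P+1` carry all left labels except
  `2P, 2P+1` (`IK2020.labN`). Both are duplex fillings of the same rectangle with every label
  `m` times, which is all the printed argument uses; the pair filling keeps the box arithmetic
  within linear arithmetic (`omega`). Our pigeonhole for step 3 is phrased for this filling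
  (two left labels with equal `φ`-value lie together in every column pair `P ∉ {a/2, b/2}`, and
  there are `m/2 + 1 ≥ 3` pairs) instead of IK's divisibility count `m ∤ m + 2`.

Internally `m = 2k + 4`; `IK2020_prop_5_3_1_holds` substitutes `m = 2(r−2) + 4` for even
`m = r + r ≥ 4`. The sorted parts of `ikPartition` are re-derived privately (they are also
`IK2020.sortedParts_ikPartition` of `PowerSumProductObstructionsProofs.lean`, not imported here).

NOT here: IK's exact values `mult_{ν^*} ℂ[Gp] = 2` (Prop. 4.1 / Lemma 5.2) and
`a_ν(2(m+1), m) ≥ 3` (Prop. 12.1 needs, besides `f`, the two non-vanishing functions of the Main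
Technical Theorem 4.2); `IK2020_thm_4_3` stays a named fact.

## References

* C. Ikenmeyer, U. Kandasamy, Proc. 52nd ACM STOC (2020) 713–726 = arXiv:1911.03990: §3
  (tableaux, duplex), Prop. 5.3, Thm. 11.1, §12 (Prop. 12.1, Claim 12.2). [IkenmeyerKandasamy2019]
* J. Dörfler, C. Ikenmeyer, G. Panova, SIAM J. Appl. Algebra Geom. 4 (2020), §5 (highest-weight
  vectors from tableaux and their evaluation; `mult = dim HWV − #equations`).
  [DorflerIkenmeyerPanova2020]
* P. Bürgisser, M. Christandl, C. Ikenmeyer, *Even partitions in plethysms*, J. Algebra 328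
  (2011) (duplex tableaux / products of squares). [BurgisserChristandlIkenmeyer2011Even]

## Mathlib and tree

Tree: `TabM`, `tabPoly`, `EC`, `aeval_formCoeff_tabPoly`, `symEntryM`, `splfPoly`, `linForm_single`
(`TableauPolynomial`, `TableauPolarization`, `TableauHighestWeight`), `TabM.Frame`, `mapForms`,
`linSubst_splfPoly`, `IsAntitoneEnum` (`TableauScaling`), `mem_orbitVanishingIdeal_iff`,
`linSubstRep_apply` (`OrbitCoordinateRing`, `LinSubst`),
`orbitMultiplicity_lt_plethysmCoeff_of_mem_orbitVanishingIdeal` (`HwvIdealRankBound`),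
`ikPartition`, `IK2020_prop_5_3_1` (`PowerSumProductObstructions`). Mathlib: `Matrix.permanent`,
`Matrix.vandermonde`/`det_vandermonde_ne_zero_iff`, `Matrix.det_apply'`,
`Matrix.det_zero_of_column_eq`, `Fintype.exists_ne_map_eq_of_card_lt`, `Fintype.prod_sum`,
`Fin.card_filter_val_lt`, `Int.cast_det`.
-/

noncomputable section

open scoped BigOperators

namespace Literature.Computability.AlgebraicComplexity

namespace TableauEval

open MvPolynomial

variable {σ : Type*} [Fintype σ] {K : Type*} [CommRing K]

/-! ### §2 Evaluation of a tableau polynomial at a sum of powers of linear forms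
(IK Thm. 11.1: "`f(y) = ⟨π v_λ, y^{⊗δ}⟩ = ∑_φ ∏_c det(…)`", `y = ℓ₁^D + ⋯ + ℓ_n^D`) -/

/-- The permanent of a square matrix all of whose rows are the same vector `a` is `m! · ∏ a`.
[folklore] -/
private theorem permanent_of_rows_eq {m : ℕ} (a : Fin m → K) :
    (Matrix.of fun (_ s' : Fin m) => a s').permanent = (m.factorial : K) * ∏ s, a s := by
  unfold Matrix.permanent
  simp only [Matrix.of_apply, Finset.sum_const, Finset.card_univ, Fintype.card_perm,
    Fintype.card_fin, nsmul_eq_mul]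

/-- The symmetric-tensor entry of a sum of `m`-th powers `∑_j c_j ℓ_j^m` (every term has all its
`m` linear forms equal) at a word `w`: `m! · ∑_j c_j ∏_s ℓ_j(w_s)`. [folklore] -/
private theorem symEntryM_powers {n m : ℕ} (coef : Fin n → K) (ℓ : Fin n → σ → K)
    (w : Fin m → σ) :
    symEntryM coef (fun j (_ : Fin m) => ℓ j) w =
      (m.factorial : K) * ∑ j, coef j * ∏ s, ℓ j (w s) := by
  unfold symEntryM
  rw [Finset.mul_sum]
  refine Finset.sum_congr rfl fun j _ => ?_
  rw [permanent_of_rows_eq fun s' => ℓ j (w s')]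
  ring

namespace TabM

variable (τ : TabM σ)

/-- **Evaluation at a sum of powers of linear forms** (the formula of IK Thm. 11.1 /
[AIR16]/[BIP19] for `γ(A M_{δ,m} T)`): for a tableau datum `τ` with a frame, the mathematical
evaluator at the presentation `∑_{j<n} c_j ℓ_j^m` is
`(m!)^d · ∑_{φ : labels → terms} (∏_u c_{φ u}) · ∏_c det (ℓ_{φ(label of box (c,r))}(var c i))`.
Proof: expand each label's entry (`symEntryM_powers`), distribute the product over labels into
a sum over `φ` (`Fintype.prod_sum`), regroup the boxes by columns through the frame, and collect
the signed sum over column bijections into one determinant per column (`Matrix.det_apply'`), as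
in `EC_mapForms_expand`. [cite: IkenmeyerKandasamy2019, Thm. 11.1 (proof)] -/
theorem EC_powers (F : τ.Frame) {n : ℕ} (coef : Fin n → K) (ℓ : Fin n → σ → K) :
    τ.EC coef (fun j (_ : Fin τ.m) => ℓ j) =
      (τ.m.factorial : K) ^ τ.d * ∑ φ : Fin τ.d → Fin n,
        (∏ u, coef (φ u)) *
          ∏ c, (Matrix.of fun i r : Fin (τ.h c) =>
            ℓ (φ (F.boxEquiv.symm ⟨c, r⟩).1) (τ.var c i)).det := by
  classical
  -- Step 1: every π: expand the product over labels into a sum over `φ`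
  have h1 : ∀ π : τ.Bij, ∏ u, symEntryM coef (fun j (_ : Fin τ.m) => ℓ j) (τ.word π u) =
      (τ.m.factorial : K) ^ τ.d * ∑ φ : Fin τ.d → Fin n,
        (∏ u, coef (φ u)) * ∏ u, ∏ s, ℓ (φ u) (τ.word π u s) := by
    intro π
    simp only [symEntryM_powers]
    rw [Finset.prod_mul_distrib, Finset.prod_const, Finset.card_univ, Fintype.card_fin]
    congr 1
    rw [Fintype.prod_sum fun u j => coef j * ∏ s, ℓ j (τ.word π u s)]
    refine Finset.sum_congr rfl fun φ _ => ?_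
    rw [Finset.prod_mul_distrib]
  -- Step 2: regroup the boxes of all labels by columns, through the frame
  have h2 : ∀ (π : τ.Bij) (φ : Fin τ.d → Fin n),
      ∏ u, ∏ s, ℓ (φ u) (τ.word π u s) =
        ∏ c, ∏ r : Fin (τ.h c),
          ℓ (φ (F.boxEquiv.symm ⟨c, r⟩).1) (τ.var c (π c r)) := by
    intro π φ
    rw [← Fintype.prod_prod_type', ← Fintype.prod_sigma' fun c (r : Fin (τ.h c)) =>
      ℓ (φ (F.boxEquiv.symm ⟨c, r⟩).1) (τ.var c (π c r)), ← F.boxEquiv.prod_comp]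
    refine Finset.prod_congr rfl fun p _ => ?_
    obtain ⟨u, s⟩ := p
    simp only [TabM.word, Sigma.eta, Equiv.symm_apply_apply]
    rw [F.box_eq u s]
  -- Step 3: the signed sum over column bijections is the product of the column determinants
  have h3 : ∀ φ : Fin τ.d → Fin n,
      ∑ π : τ.Bij, ((τ.sgnProd π : ℤ) : K) *
          ∏ c, ∏ r : Fin (τ.h c), ℓ (φ (F.boxEquiv.symm ⟨c, r⟩).1) (τ.var c (π c r)) =
        ∏ c, (Matrix.of fun i r : Fin (τ.h c) =>
          ℓ (φ (F.boxEquiv.symm ⟨c, r⟩).1) (τ.var c i)).det := by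
    intro φ
    simp only [TabM.sgnProd, Units.coe_prod, Int.cast_prod, ← Finset.prod_mul_distrib]
    rw [← Fintype.prod_sum fun c (ρ : Equiv.Perm (Fin (τ.h c))) =>
      ((Equiv.Perm.sign ρ : ℤ) : K) *
        ∏ r, ℓ (φ (F.boxEquiv.symm ⟨c, r⟩).1) (τ.var c (ρ r))]
    refine Finset.prod_congr rfl fun c _ => ?_
    rw [Matrix.det_apply']
    rfl
  unfold EC
  simp only [h1, h2, Finset.mul_sum]
  rw [Finset.sum_comm]
  refine Finset.sum_congr rfl fun φ _ => ?_
  rw [← h3 φ, Finset.mul_sum, Finset.mul_sum]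
  refine Finset.sum_congr rfl fun π _ => ?_
  ring

end TabM

end TableauEval

namespace IK2020

open TableauEval MvPolynomial
open _root_.Literature.NumberTheory.DiophantineGeometry

/-! ### §1 Ikenmeyer–Kandasamy's duplex tableau `T = T_left + T_right` of shape `ν`

Throughout `m = 2k + 4` (the even `m ≥ 4` of IK Thm. 4.3), `d = 2m + 2 = 4k + 10` labels with
`m` boxes each, `4m = 8k + 16` columns: columns `c < m + 2` form `T_left` (height `m`), columns
`m + 2 ≤ c < 2m` the `m - 2` full columns of `T_right` (height `m`), columns `2m ≤ c < 4m` the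
`2m` singleton columns of `T_right`. -/

variable (k : ℕ)

/-- Column heights of `T`: `m` for the first `2m` columns (those of `T_left` and the full columns
of `T_right`), `1` for the last `2m` (the singleton columns of `T_right`).
[cite: IkenmeyerKandasamy2019, §12 (proof of Prop. 12.1)] -/
def hgt (k c : ℕ) : ℕ := if c < 4 * k + 8 then 2 * k + 4 else 1

/-- Every column has height `≤ m`. [folklore] -/
private theorem hgt_le (c : ℕ) : hgt k c ≤ 2 * k + 4 := by
  unfold hgt; split_ifs <;> omega

/-- The label (a number `< 2m+2`) carried by the box of `T` in column `c`, row `r`: in `T_left`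
the columns `2P, 2P+1` carry, top to bottom, all left labels `0, …, m+1` except `2P, 2P+1` (the
column-pair filling, see the file header); the full columns of `T_right` carry `m+2, …, 2m+1`;
the singleton columns `2m + 2t, 2m + 2t + 1` carry `m + 2 + t`.
[cite: IkenmeyerKandasamy2019, §12 (proof of Prop. 12.1)] -/
def labN (k c r : ℕ) : ℕ :=
  if c < 2 * k + 6 then (if r < 2 * (c / 2) then r else r + 2)
  else if c < 4 * k + 8 then 2 * k + 6 + r else 2 * k + 6 + (c - (4 * k + 8)) / 2

/-- The index of the box `(c, r)` among the `m` boxes of its label (the boxes of a label are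
enumerated by increasing column). [cite: IkenmeyerKandasamy2019, §12 (proof of Prop. 12.1)] -/
def idxN (k c r : ℕ) : ℕ :=
  if c < 2 * k + 6 then (if c < 2 * (labN k c r / 2) then c else c - 2)
  else if c < 4 * k + 8 then c - (2 * k + 6) else 2 * k + 2 + (c - (4 * k + 8)) % 2

/-- The column of the `s`-th box of label `u` (inverse to `labN`/`idxN`).
[cite: IkenmeyerKandasamy2019, §12 (proof of Prop. 12.1)] -/
def colN (k u s : ℕ) : ℕ :=
  if u < 2 * k + 6 then (if s < 2 * (u / 2) then s else s + 2)
  else if s < 2 * k + 2 then 2 * k + 6 + s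
  else 4 * k + 8 + 2 * (u - (2 * k + 6)) + (s - (2 * k + 2))

/-- The row of the `s`-th box of label `u` (inverse to `labN`/`idxN`).
[cite: IkenmeyerKandasamy2019, §12 (proof of Prop. 12.1)] -/
def rowN (k u s : ℕ) : ℕ :=
  if u < 2 * k + 6 then (if u < 2 * (colN k u s / 2) then u else u - 2)
  else if s < 2 * k + 2 then u - (2 * k + 6) else 0

/-- Boxes sit in columns `< 4m`. [folklore] -/
private theorem colN_lt {u s : ℕ} (hu : u < 4 * k + 10) (hs : s < 2 * k + 4) :
    colN k u s < 8 * k + 16 := by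
  unfold colN; split_ifs <;> omega

/-- Boxes sit in rows below the height of their column. [folklore] -/
private theorem rowN_lt {u s : ℕ} (hu : u < 4 * k + 10) (hs : s < 2 * k + 4) :
    rowN k u s < hgt k (colN k u s) := by
  unfold rowN hgt colN; split_ifs <;> omega

/-- Labels are `< 2m + 2`. [cite: IkenmeyerKandasamy2019, §12 (proof of Prop. 12.1)] -/
theorem labN_lt {c r : ℕ} (hc : c < 8 * k + 16) (hr : r < hgt k c) : labN k c r < 4 * k + 10 := by
  unfold labN; unfold hgt at hr; split_ifs at hr ⊢ <;> omega

/-- Box indices are `< m` (every label has `m` boxes). [folklore] -/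
private theorem idxN_lt {c r : ℕ} (hc : c < 8 * k + 16) (hr : r < hgt k c) :
    idxN k c r < 2 * k + 4 := by
  unfold idxN labN; unfold hgt at hr; split_ifs at hr ⊢ <;> omega

/-- `(label, index) ↦ box ↦ label` is the identity. [folklore] -/
private theorem labN_colN_rowN {u s : ℕ} (hs : s < 2 * k + 4) :
    labN k (colN k u s) (rowN k u s) = u := by
  unfold labN rowN colN; split_ifs <;> omega

/-- `(label, index) ↦ box ↦ index` is the identity. [folklore] -/
private theorem idxN_colN_rowN {u s : ℕ} (hs : s < 2 * k + 4) :
    idxN k (colN k u s) (rowN k u s) = s := by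
  unfold idxN; rw [labN_colN_rowN k hs]; unfold colN; split_ifs <;> omega

/-- `box ↦ (label, index) ↦ column` is the identity. [folklore] -/
private theorem colN_labN_idxN {c r : ℕ} (hc : c < 8 * k + 16) (hr : r < hgt k c) :
    colN k (labN k c r) (idxN k c r) = c := by
  unfold colN idxN labN; unfold hgt at hr; split_ifs at hr ⊢ <;> omega

/-- `box ↦ (label, index) ↦ row` is the identity. [folklore] -/
private theorem rowN_labN_idxN {c r : ℕ} (hc : c < 8 * k + 16) (hr : r < hgt k c) :
    rowN k (labN k c r) (idxN k c r) = r := by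
  unfold rowN; rw [colN_labN_idxN k hc hr]; unfold idxN labN; unfold hgt at hr
  split_ifs at hr ⊢ <;> omega


/-! ### §1b The datum, its frame and the antitone enumeration of the variables -/

/-- The antitone enumeration `x i = m - 1 - i` of the variables `Fin m` (largest first), on
which the column alternators sit (the tree's upper-triangular Borel convention for the
contragredient action on `ℂ[Sym^m]`, `TableauHighestWeight.lean`; IK §6: "for all upper
triangular matrices …"). [cite: IkenmeyerKandasamy2019, §6 and Thm. 11.1] -/
def xEnum (k i : ℕ) : Fin (2 * k + 4) := ⟨2 * k + 3 - i, by omega⟩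

/-- Value of the enumeration. [folklore] -/
@[simp] private theorem xEnum_val (i : ℕ) : (xEnum k i : ℕ) = 2 * k + 3 - i := rfl

/-- `x` is an antitone enumeration of `Fin m`. [folklore] -/
private theorem isAntitoneEnum_xEnum : IsAntitoneEnum (xEnum k) (2 * k + 4) where
  anti i j hij hj := by
    rw [Fin.lt_def, xEnum_val, xEnum_val]
    omega
  surj v := ⟨2 * k + 3 - v, by omega, Fin.ext (by rw [xEnum_val]; omega)⟩

/-- **Ikenmeyer–Kandasamy's tableau** `T = T_left + T_right` (IK §12, with `T_right` of shape
`(m × (m-2)) + (2m)`, see the file header) as a tableau datum of the tree: `4m` columns, `2m+2`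
labels with `m` boxes each, alternators on the largest variables.
[cite: IkenmeyerKandasamy2019, §12 (proof of Prop. 12.1)] -/
def ikTab (k : ℕ) : TabM (Fin (2 * k + 4)) where
  C := 8 * k + 16
  d := 4 * k + 10
  m := 2 * k + 4
  h c := hgt k c
  var _ i := xEnum k i
  box u s := ⟨⟨colN k u s, colN_lt k u.2 s.2⟩, ⟨rowN k u s, rowN_lt k u.2 s.2⟩⟩

/-- `T` has `4m` columns. [folklore] -/
@[simp] private theorem ikTab_C : (ikTab k).C = 8 * k + 16 := rfl
/-- `T` has `2m + 2` labels. [folklore] -/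
@[simp] private theorem ikTab_d : (ikTab k).d = 4 * k + 10 := rfl
/-- Every label of `T` has `m` boxes. [folklore] -/
@[simp] private theorem ikTab_m : (ikTab k).m = 2 * k + 4 := rfl
/-- The column heights of `T`. [folklore] -/
private theorem ikTab_h (c : Fin (ikTab k).C) : (ikTab k).h c = hgt k c := rfl

/-- Two boxes with the same column and row numbers are equal. [folklore] -/
private theorem box_ext {n : ℕ} {η : Fin n → ℕ} {b b' : (c : Fin n) × Fin (η c)}
    (h1 : (b.1 : ℕ) = b'.1) (h2 : (b.2 : ℕ) = b'.2) : b = b' := by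
  obtain ⟨c, r⟩ := b
  obtain ⟨c', r'⟩ := b'
  obtain rfl : c = c' := Fin.ext h1
  obtain rfl : r = r' := Fin.ext h2
  rfl

/-- The (label, index) of a box of `T`.
[cite: IkenmeyerKandasamy2019, §12 (proof of Prop. 12.1)] -/
def labBox (b : (c : Fin (ikTab k).C) × Fin ((ikTab k).h c)) :
    Fin (ikTab k).d × Fin (ikTab k).m :=
  (⟨labN k b.1 b.2, labN_lt k b.1.2 b.2.2⟩, ⟨idxN k b.1 b.2, idxN_lt k b.1.2 b.2.2⟩)

/-- The frame of IK's tableau: boxes ↔ (label, index), i.e. the datum is an honest tableau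
with content `(2m+2) × m`. [cite: IkenmeyerKandasamy2019, §12 (proof of Prop. 12.1)] -/
def ikFrame (k : ℕ) : (ikTab k).Frame where
  boxEquiv :=
    { toFun := fun p => (ikTab k).box p.1 p.2
      invFun := labBox k
      left_inv := fun p => by
        obtain ⟨u, s⟩ := p
        refine Prod.ext (Fin.ext ?_) (Fin.ext ?_)
        · exact labN_colN_rowN k s.2
        · exact idxN_colN_rowN k s.2
      right_inv := fun b =>
        box_ext (colN_labN_idxN k b.1.2 b.2.2) (rowN_labN_idxN k b.1.2 b.2.2) }
  box_eq _ _ := rfl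


/-! ### §1c The shape of `T` is `ν = (4m, 2m, …, 2m)` -/

/-- The sorted parts of `ν = ikPartition m` for `m ≥ 1` (also proved, in the same words, as
`IK2020.sortedParts_ikPartition` in `PowerSumProductObstructionsProofs.lean`; repeated here to
keep this file's imports to modules built on every check node).
[cite: IkenmeyerKandasamy2019, Thm. 4.3] -/
private theorem sortedParts_ikPartition' {m : ℕ} (hm : 1 ≤ m) :
    (ikPartition m).sortedParts = (4 * m) :: List.replicate (m - 1) (2 * m) := by
  change (ikPartition m).parts.sort (· ≥ ·) = _
  have hparts : (ikPartition m).parts = ↑((4 * m) :: List.replicate (m - 1) (2 * m)) := by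
    change Multiset.filter (· ≠ 0) ({4 * m} + Multiset.replicate (m - 1) (2 * m)) = _
    rw [Multiset.filter_eq_self.mpr, Multiset.singleton_add, ← Multiset.coe_replicate,
      Multiset.cons_coe]
    intro a ha
    simp only [Multiset.mem_add, Multiset.mem_singleton, Multiset.mem_replicate] at ha
    omega
  rw [hparts, Multiset.coe_sort]
  apply List.mergeSort_eq_self
  rw [List.pairwise_cons]
  refine ⟨fun b hb => ?_, List.pairwise_replicate.mpr (Or.inr le_rfl)⟩
  rw [List.mem_replicate] at hb
  omega

/-- The weight `ν^*` at the `i`-th largest variable is `-ν_i`: `-4m` for `i = 0`, `-2m` for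
`0 < i < m`. [cite: IkenmeyerKandasamy2019, Thm. 4.3] -/
private theorem dualOfPartition_ikPartition_xEnum (i : ℕ) (hi : i < 2 * k + 4) :
    Weight.dualOfPartition (2 * k + 4) (ikPartition (2 * k + 4)) (xEnum k i) =
      -((if i = 0 then 8 * k + 16 else 4 * k + 8 : ℕ) : ℤ) := by
  unfold Weight.dualOfPartition Weight.dual Weight.ofPartition
  rw [sortedParts_ikPartition' (by omega)]
  have hrev : ((Fin.rev (xEnum k i) : Fin (2 * k + 4)) : ℕ) = i := by
    rw [Fin.val_rev, xEnum_val]; omega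
  rw [hrev]
  congr 2
  rcases Nat.eq_zero_or_pos i with rfl | hpos
  · rw [List.getD_cons_zero, if_pos rfl]; ring
  · obtain ⟨j, rfl⟩ : ∃ j, i = j + 1 := ⟨i - 1, by omega⟩
    rw [List.getD_cons_succ, List.getD_eq_getElem _ _ (by rw [List.length_replicate]; omega),
      List.getElem_replicate, if_neg (by omega)]
    omega

/-- The number of columns of `T` of height `> i` is `ν_i`: `sh(T) = ν`. [folklore] -/
private theorem card_filter_lt_hgt (i : ℕ) (hi : i < 2 * k + 4) :
    (Finset.univ.filter fun c : Fin (ikTab k).C => i < (ikTab k).h c).card =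
      (if i = 0 then 8 * k + 16 else 4 * k + 8 : ℕ) := by
  split_ifs with h0
  · subst h0
    rw [Finset.filter_true_of_mem, Finset.card_univ, ikTab_C, Fintype.card_fin]
    intro c _
    rw [ikTab_h]; unfold hgt; split_ifs <;> omega
  · show (Finset.univ.filter fun c : Fin (8 * k + 16) => i < hgt k c).card = _
    have hset : (Finset.univ.filter fun c : Fin (8 * k + 16) => i < hgt k c) =
        Finset.univ.filter fun c : Fin (8 * k + 16) => (c : ℕ) < 4 * k + 8 := by
      apply Finset.filter_congr
      intro c _
      unfold hgt
      constructor
      · intro h; by_contra hc; rw [if_neg hc] at h; omega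
      · intro hc; rw [if_pos hc]; omega
    rw [hset, Fin.card_filter_val_lt]
    omega

/-- **IK's third function** `f = F_T ∈ ℂ[Sym^m ℂ^m]_{2m+2}`: the tableau polynomial of `T`
(`TabM.tabPoly`, the tree's rendering of `A ↦ γ(A M_{δ,m} T)` / DIP's `v_T`-contraction), with
its type spelled in terms of `m = 2k+4`.
[cite: IkenmeyerKandasamy2019, §12 (proof of Prop. 12.1)] -/
def ikPoly (k : ℕ) : MvPolynomial (DegIdx (Fin (2 * k + 4)) (2 * k + 4)) ℂ :=
  (ikTab k).tabPoly ℂ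

/-- **IK's tableau polynomial is a highest-weight vector of weight `ν^*`** in
`ℂ[Sym^m ℂ^m] = ⊕_δ Sym^δ (Sym^m ℂ^m)^*` (IK Thm. 11.1, last clause: "the function
`A ↦ γ(A M_{δ,m} T)` is either zero or a HWV of weight `λ^*`"; tree:
`TabM.tabPoly_mem_highestWeightSpace`). [cite: IkenmeyerKandasamy2019, Thm. 11.1] -/
theorem ikPoly_mem_highestWeightSpace :
    ikPoly k ∈ highestWeightSpace (coordRep (Fin (2 * k + 4)) ℂ (2 * k + 4))
      (Weight.dualOfPartition (2 * k + 4) (ikPartition (2 * k + 4))) := by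
  refine (ikTab k).tabPoly_mem_highestWeightSpace (ikFrame k) (isAntitoneEnum_xEnum k)
    (fun c => ?_) (fun c r => rfl) _ (fun i hi => ?_)
  · rw [ikTab_h]; unfold hgt; split_ifs <;> omega
  · rw [dualOfPartition_ikPartition_xEnum k i hi, card_filter_lt_hgt k i hi]


/-! ### §3 The tableau polynomial vanishes on the orbit of the power sum -/

/-- The coordinate presentation of the power sum: `x₁^m + ⋯ + x_N^m = ∑_j 1 · (e_j)^m`.
[folklore] -/
private theorem psum_eq_splfPoly (N m : ℕ) (K : Type*) [CommRing K] :
    psum (Fin N) K m =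
      splfPoly (fun _ : Fin N => (1 : K)) (fun j (_ : Fin m) => Pi.single j 1) := by
  unfold splfPoly
  rw [psum]
  refine Finset.sum_congr rfl fun j _ => ?_
  rw [C_1, one_mul, Finset.prod_const, Finset.card_univ, Fintype.card_fin, linForm_single]

/-- **Value of IK's tableau polynomial at a point `A · p` of the orbit (or its boundary)**,
`A · p = ∑_j (A e_j)^m`: `(m!)^{2m+2} ∑_φ ∏_c det (A_{x_i, φ(label(c,r))})_{i,r}` (IK Thm. 11.1:
"`g ↦ γ(g M_{δ,m} T)`"). [cite: IkenmeyerKandasamy2019, Thm. 11.1] -/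
theorem aeval_linSubst_psum_ikPoly (A : Matrix (Fin (2 * k + 4)) (Fin (2 * k + 4)) ℂ) :
    aeval (formCoeff (2 * k + 4)
        (linSubst (Fin (2 * k + 4)) ℂ A (psum (Fin (2 * k + 4)) ℂ (2 * k + 4)))) (ikPoly k) =
      ((2 * k + 4).factorial : ℂ) ^ (4 * k + 10) * ∑ φ : Fin (4 * k + 10) → Fin (2 * k + 4),
        ∏ c : Fin (8 * k + 16), (Matrix.of fun i r : Fin (hgt k c) =>
          A (xEnum k i) (φ ⟨labN k c r, labN_lt k c.2 r.2⟩)).det := by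
  rw [psum_eq_splfPoly, linSubst_splfPoly]
  have hmap :
      mapForms A (fun (j : Fin (2 * k + 4)) (_ : Fin (2 * k + 4)) => (Pi.single j (1 : ℂ))) =
        fun j _ => A.col j := by
    funext j s
    simp only [mapForms, Matrix.mulVec_single_one]
  rw [hmap]
  refine ((ikTab k).aeval_formCoeff_tabPoly (K := ℂ) (fun _ => (1 : ℂ))
    (fun j _ => A.col j)).trans ?_
  rw [(ikTab k).EC_powers (ikFrame k)]
  simp only [Finset.prod_const_one, one_mul]
  rfl

/-- **Pigeonhole on `T_left`** (IK §12: "no tableau in `M_{m+2,m} T_left` is regular … every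
symbol in `M_{m+2,m} T_left` appears a multiple of `m` many times"): every relabelling of the
`m+2` left labels by `m` values repeats a value inside some column of `T_left`. (With the
column-pair filling: two left labels `a ≠ b` with `φ a = φ b` both occur in every column pair
`P ∉ {a/2, b/2}`, and there are `m/2 + 1 ≥ 3` pairs.)
[cite: IkenmeyerKandasamy2019, §12 (proof of Prop. 12.1)] -/
theorem exists_column_repeat (φ : Fin (4 * k + 10) → Fin (2 * k + 4)) :
    ∃ (c : Fin (8 * k + 16)) (r r' : Fin (hgt k c)), r ≠ r' ∧
      φ ⟨labN k c r, labN_lt k c.2 r.2⟩ = φ ⟨labN k c r', labN_lt k c.2 r'.2⟩ := by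
  -- restrict `φ` to the left labels `0, …, m+1`
  let g : Fin (2 * k + 6) → Fin (2 * k + 4) := fun a => φ ⟨a, by omega⟩
  obtain ⟨a, b, hab, hg⟩ := Fintype.exists_ne_map_eq_of_card_lt g (by simp)
  -- a column pair containing both `a` and `b`
  let P : ℕ := if (a : ℕ) / 2 ≠ 0 ∧ (b : ℕ) / 2 ≠ 0 then 0
    else if (a : ℕ) / 2 ≠ 1 ∧ (b : ℕ) / 2 ≠ 1 then 1 else 2
  have hPa : (a : ℕ) / 2 ≠ P := by
    simp only [P]; split_ifs <;> omega
  have hPb : (b : ℕ) / 2 ≠ P := by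
    simp only [P]; split_ifs <;> omega
  have hP2 : P ≤ 2 := by simp only [P]; split_ifs <;> omega
  have hab' : (a : ℕ) ≠ b := fun h => hab (Fin.ext h)
  have hc : 2 * P < 8 * k + 16 := by omega
  have hh : hgt k (2 * P) = 2 * k + 4 := by unfold hgt; rw [if_pos (by omega)]
  -- the rows of `a` and `b` in column `2P`
  let ra : ℕ := if (a : ℕ) < 2 * P then a else a - 2
  let rb : ℕ := if (b : ℕ) < 2 * P then b else b - 2
  have hra : ra < hgt k (2 * P) := by rw [hh]; simp only [ra]; split_ifs <;> omega
  have hrb : rb < hgt k (2 * P) := by rw [hh]; simp only [rb]; split_ifs <;> omega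
  have hla : labN k (2 * P) ra = a := by
    unfold labN; simp only [ra]; split_ifs <;> omega
  have hlb : labN k (2 * P) rb = b := by
    unfold labN; simp only [rb]; split_ifs <;> omega
  refine ⟨⟨2 * P, hc⟩, ⟨ra, hra⟩, ⟨rb, hrb⟩, ?_, ?_⟩
  · intro h
    have h' : ra = rb := congrArg Fin.val h
    apply hab'
    rw [← hla, ← hlb, h']
  · have ha : (⟨labN k (2 * P) ra, labN_lt k hc hra⟩ : Fin (4 * k + 10)) = ⟨a, by omega⟩ :=
      Fin.ext hla
    have hb : (⟨labN k (2 * P) rb, labN_lt k hc hrb⟩ : Fin (4 * k + 10)) = ⟨b, by omega⟩ :=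
      Fin.ext hlb
    rw [ha, hb]
    exact hg

/-- **IK's tableau polynomial vanishes at every `A · p`** (IK §12: "all summands in
`γ(g M_{n,m} T)` are zero"): each summand has a `T_left` column determinant with two equal
columns. [cite: IkenmeyerKandasamy2019, §12 (proof of Prop. 12.1)] -/
theorem aeval_linSubst_psum_ikPoly_eq_zero (A : Matrix (Fin (2 * k + 4)) (Fin (2 * k + 4)) ℂ) :
    aeval (formCoeff (2 * k + 4)
        (linSubst (Fin (2 * k + 4)) ℂ A (psum (Fin (2 * k + 4)) ℂ (2 * k + 4)))) (ikPoly k) =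
      0 := by
  rw [aeval_linSubst_psum_ikPoly, mul_eq_zero]
  refine Or.inr (Finset.sum_eq_zero fun φ _ => ?_)
  obtain ⟨c, r, r', hrr', hφ⟩ := exists_column_repeat k φ
  exact Finset.prod_eq_zero (Finset.mem_univ c)
    (Matrix.det_zero_of_column_eq hrr' fun i => by simp only [Matrix.of_apply, hφ])

/-- Hence `f = F_T ∈ I(GL_m · p)`, the vanishing ideal of the orbit of the power sum ("`f`
vanishes on `Gp`"). [cite: IkenmeyerKandasamy2019, §12 (proof of Prop. 12.1)] -/
theorem ikPoly_mem_orbitVanishingIdeal :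
    ikPoly k ∈ orbitVanishingIdeal (psum (Fin (2 * k + 4)) ℂ (2 * k + 4)) (2 * k + 4) := by
  rw [mem_orbitVanishingIdeal_iff]
  intro g
  rw [linSubstRep_apply]
  exact aeval_linSubst_psum_ikPoly_eq_zero k _

/-! ### §4 The tableau polynomial is not zero: duplex positivity at an integer point -/

/-- The labels down a column of `T` are distinct (every column is regular). [folklore] -/
private theorem labN_injective {c r r' : ℕ} (hr : r < hgt k c) (hr' : r' < hgt k c)
    (h : labN k c r = labN k c r') : r = r' := by
  unfold labN at h; unfold hgt at hr hr'; split_ifs at h hr hr' <;> omega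

/-- **`T` is duplex**, heights: columns `2P` and `2P + 1` have the same height.
[cite: IkenmeyerKandasamy2019, §12 ("We observe that `T` is duplex")] -/
theorem hgt_bit1 (P : ℕ) : hgt k (2 * P + 1) = hgt k (2 * P) := by
  unfold hgt; split_ifs <;> omega

/-- **`T` is duplex**, labels: columns `2P` and `2P + 1` carry the same labels.
[cite: IkenmeyerKandasamy2019, §12 ("We observe that `T` is duplex")] -/
theorem labN_bit1 (P : ℕ) : labN k (2 * P + 1) = labN k (2 * P) := by
  funext r; unfold labN; split_ifs <;> omega

/-- A product over `range (2n)` regrouped in consecutive pairs. [folklore] -/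
private theorem prod_range_two_mul {M : Type*} [CommMonoid M] (f : ℕ → M) (n : ℕ) :
    ∏ c ∈ Finset.range (2 * n), f c = ∏ P ∈ Finset.range n, f (2 * P) * f (2 * P + 1) := by
  induction n with
  | zero => simp
  | succ n ih =>
    rw [show 2 * (n + 1) = 2 * n + 1 + 1 by ring, Finset.prod_range_succ, Finset.prod_range_succ,
      ih, Finset.prod_range_succ, mul_assoc]

/-- The Vandermonde determinant of a column of height `n` with label function `g` under a
relabelling `Φ : ℕ → ℕ`: `det ((Φ (g r) + 1)^i)_{i,r} ∈ ℤ` — the column factor of IK's summand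
`γ(A φT)` at the integer point `ptForm` (IK Claim 12.2 takes a generic real `A`).
[cite: IkenmeyerKandasamy2019, §12 (Claim 12.2)] -/
def vdet (n : ℕ) (Φ g : ℕ → ℕ) : ℤ :=
  (Matrix.vandermonde fun r : Fin n => ((Φ (g r) : ℕ) : ℤ) + 1).det

/-- The integer point `ℓ₁^m + ⋯ + ℓ_{2m+2}^m`, `ℓ_j = ((j+1)^{m-1-v})_v`, so that
`ℓ_j(x_i) = (j+1)^i` (in place of IK's generic real `m × n` matrix `A`).
[cite: IkenmeyerKandasamy2019, §12 (Claim 12.2)] -/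
def ptForm (k : ℕ) (j : Fin (4 * k + 10)) (v : Fin (2 * k + 4)) : ℂ :=
  ((j : ℕ) + 1 : ℂ) ^ (2 * k + 3 - (v : ℕ))

/-- Extension of a relabelling `φ : [2m+2] → [2m+2]` (IK's `φ ∈ M_{n,n}`) to all naturals
(junk `0` beyond `2m+2`). [cite: IkenmeyerKandasamy2019, §7 (`M_{δ,m}`)] -/
def extN (φ : Fin (4 * k + 10) → Fin (4 * k + 10)) (u : ℕ) : ℕ :=
  if h : u < 4 * k + 10 then φ ⟨u, h⟩ else 0

/-- The column determinants at the integer point are the Vandermonde determinants `vdet`.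
[folklore] -/
private theorem det_ptForm_eq (φ : Fin (4 * k + 10) → Fin (4 * k + 10)) (c : Fin (8 * k + 16)) :
    (Matrix.of fun i r : Fin (hgt k c) =>
        ptForm k (φ ⟨labN k c r, labN_lt k c.2 r.2⟩) (xEnum k i)).det =
      ((vdet (hgt k c) (extN k φ) (labN k c) : ℤ) : ℂ) := by
  unfold vdet
  rw [Int.cast_det]
  conv_rhs => rw [← Matrix.det_transpose]
  congr 1
  ext i r
  have hi : (i : ℕ) ≤ 2 * k + 3 := by
    have h1 := i.2; have h2 := hgt_le k (c : ℕ); omega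
  have hext : extN k φ (labN k c r) = φ ⟨labN k c r, labN_lt k c.2 r.2⟩ := by
    unfold extN; rw [dif_pos (labN_lt k c.2 r.2)]
  simp only [Matrix.transpose_apply, Matrix.map_apply, Matrix.of_apply, Matrix.vandermonde_apply,
    ptForm, xEnum_val, hext]
  push_cast
  congr 1
  omega


/-- **Duplex positivity** (IK Claim 12.2, after [BCI10]: "each factor in the product appears an
even number of times and hence the product is nonnegative … for the identity map … `> 0` … Any
finite sum of nonnegative numbers that contains at least one positive number is nonzero"): the
sum over relabellings of the products of the column determinants at the integer point is a
positive integer. [cite: IkenmeyerKandasamy2019, §12 (Claim 12.2)] -/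
theorem sum_prod_vdet_pos :
    0 < ∑ φ : Fin (4 * k + 10) → Fin (4 * k + 10),
      ∏ c : Fin (8 * k + 16), vdet (hgt k c) (extN k φ) (labN k c) := by
  -- every product is a product of squares (columns `2P`, `2P+1` have equal determinants)
  have hsq : ∀ φ : Fin (4 * k + 10) → Fin (4 * k + 10),
      ∏ c : Fin (8 * k + 16), vdet (hgt k c) (extN k φ) (labN k c) =
        ∏ P ∈ Finset.range (4 * k + 8),
          vdet (hgt k (2 * P)) (extN k φ) (labN k (2 * P)) ^ 2 := by
    intro φ
    have e1 : (∏ c : Fin (8 * k + 16), vdet (hgt k c) (extN k φ) (labN k c)) =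
        ∏ c ∈ Finset.range (8 * k + 16), vdet (hgt k c) (extN k φ) (labN k c) :=
      Fin.prod_univ_eq_prod_range (fun c => vdet (hgt k c) (extN k φ) (labN k c)) _
    rw [e1, show 8 * k + 16 = 2 * (4 * k + 8) by ring, prod_range_two_mul]
    refine Finset.prod_congr rfl fun P _ => ?_
    rw [hgt_bit1, labN_bit1, sq]
  simp only [hsq]
  refine lt_of_lt_of_le ?_ (Finset.single_le_sum
    (f := fun φ : Fin (4 * k + 10) → Fin (4 * k + 10) =>
      ∏ P ∈ Finset.range (4 * k + 8), vdet (hgt k (2 * P)) (extN k φ) (labN k (2 * P)) ^ 2)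
    (fun φ _ => Finset.prod_nonneg fun P _ => sq_nonneg _) (Finset.mem_univ id))
  -- the identity relabelling: every column determinant is a Vandermonde in distinct integers
  refine Finset.prod_pos fun P hP => sq_pos_of_ne_zero ?_
  rw [Finset.mem_range] at hP
  unfold vdet
  rw [Matrix.det_vandermonde_ne_zero_iff]
  intro r r' h
  have hr : (r : ℕ) < hgt k (2 * P) := r.2
  have hr' : (r' : ℕ) < hgt k (2 * P) := r'.2
  have hl : labN k (2 * P) r < 4 * k + 10 := labN_lt k (by omega) hr
  have hl' : labN k (2 * P) r' < 4 * k + 10 := labN_lt k (by omega) hr'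
  have h1 : extN k id (labN k (2 * P) r) = labN k (2 * P) r := by
    unfold extN; rw [dif_pos hl]; rfl
  have h2 : extN k id (labN k (2 * P) r') = labN k (2 * P) r' := by
    unfold extN; rw [dif_pos hl']; rfl
  simp only [h1, h2] at h
  exact Fin.ext (labN_injective k hr hr' (by omega))

/-- **IK's third function is not zero** (IK Claim 12.2): its value at the integer point
`∑_{j < 2m+2} ℓ_j^m` is `(m!)^{2m+2}` times the positive integer of `sum_prod_vdet_pos`.
[cite: IkenmeyerKandasamy2019, §12 (Claim 12.2)] -/
theorem ikPoly_ne_zero : ikPoly k ≠ 0 := by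
  intro h0
  have hev : aeval (formCoeff (2 * k + 4) (splfPoly (fun _ : Fin (4 * k + 10) => (1 : ℂ))
      (fun j (_ : Fin (2 * k + 4)) => ptForm k j))) (ikPoly k) =
      ((2 * k + 4).factorial : ℂ) ^ (4 * k + 10) * ∑ φ : Fin (4 * k + 10) → Fin (4 * k + 10),
        ∏ c : Fin (8 * k + 16), (Matrix.of fun i r : Fin (hgt k c) =>
          ptForm k (φ ⟨labN k c r, labN_lt k c.2 r.2⟩) (xEnum k i)).det := by
    refine ((ikTab k).aeval_formCoeff_tabPoly (K := ℂ) (fun _ => (1 : ℂ))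
      (fun j _ => ptForm k j)).trans ?_
    rw [(ikTab k).EC_powers (ikFrame k)]
    simp only [Finset.prod_const_one, one_mul]
    rfl
  rw [h0, map_zero] at hev
  simp only [det_ptForm_eq, ← Int.cast_prod, ← Int.cast_sum] at hev
  refine absurd hev.symm (mul_ne_zero (pow_ne_zero _ ?_) ?_)
  · exact_mod_cast Nat.factorial_ne_zero _
  · exact_mod_cast (sum_prod_vdet_pos k).ne'

/-! ### §5 Assembly: IK Prop. 5.3, first bullet -/

/-- For `m = 2k + 4`: one nonzero highest-weight EQUATION of type `ν^*` for `\overline{GL_m · p}`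
exists in degree `2m + 2`, so `mult_{ν^*} ℂ[\overline{GL_m p}] < a_ν(2(m+1), m)`
(`orbitMultiplicity_lt_plethysmCoeff_of_mem_orbitVanishingIdeal`).
[cite: IkenmeyerKandasamy2019, Prop. 5.3] -/
theorem orbitMultiplicity_psum_lt_plethysmCoeff :
    orbitMultiplicity ℂ (psum (Fin (2 * k + 4)) ℂ (2 * k + 4)) (2 * k + 4)
        (Weight.dualOfPartition (2 * k + 4) (ikPartition (2 * k + 4))) <
      plethysmCoeff ℂ (Fin (2 * k + 4)) (2 * k + 4)
        (Weight.dualOfPartition (2 * k + 4) (ikPartition (2 * k + 4))) :=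
  orbitMultiplicity_lt_plethysmCoeff_of_mem_orbitVanishingIdeal (by omega)
    (ikPoly_mem_highestWeightSpace k) (ikPoly_mem_orbitVanishingIdeal k) (ikPoly_ne_zero k)

end IK2020

/-- **DISCHARGE of `IK2020_prop_5_3_1`** (Ikenmeyer–Kandasamy 2020, Prop. 5.3, first bullet):
for every even `m ≥ 4`, with `p = x₁^m + ⋯ + x_m^m` and `ν = (2m) + (m × 2m)`,
`mult_{ν^*} ℂ[\overline{GL_m p}] < a_ν(2(m+1), m)` — "hence `ν` is not a vanishing ideal
occurrence obstruction". [cite: IkenmeyerKandasamy2019, Prop. 5.3 with Prop. 12.1 and Thm. 11.1] -/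
theorem IK2020_prop_5_3_1_holds : IK2020_prop_5_3_1 := by
  intro m h4 heven
  obtain ⟨r, hr⟩ := heven
  obtain rfl : m = 2 * (r - 2) + 4 := by omega
  exact IK2020.orbitMultiplicity_psum_lt_plethysmCoeff (r - 2)

end Literature.Computability.AlgebraicComplexity

end
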